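import Literature.Geometry.Lorentzian.StationaryOrbitConfinement
import Literature.Geometry.Lorentzian.KillingOnNormInvariance
import Literature.Geometry.Lorentzian.CommutingFlowLocal
import Literature.Geometry.Lorentzian.CurvatureSymmetries
import Literature.Geometry.Lorentzian.StationaryBlackHoleUniquenessProofs
import Literature.Geometry.Lorentzian.CausalityOpennessProofs
import HarnessLib

/-!
# Two a priori bounds modulo the stationary flow of a black hole space-time: a `T`-invariant radial
function on the orbit of a compact set, and the Killing-time drift of a `T`-commuting field

Elementary consequences of `StationaryOrbitConfinement.lean` for a stationary black hole presentation
`𝓑` (`T = 𝓑.killing`, complete, with flow `θ`; Chruściel–Costa 2008, §2.2 and §4.2):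

* `exists_bound_radial_on_stationaryOrbit` — a function `ρ`, smooth on the d.o.c. with `dρ(T) = 0`
  there and `ρ < c` on the trace of an open neighbourhood of `𝓔⁺`, is bounded above on
  `⟨⟨M_ext⟩⟩ ∩ ⋃ₜ θₜ(S)` for every compact `S ⊆ ⟨⟨M_ext⟩⟩ ∪ 𝓔⁺` (split `S` at the neighbourhood; the
  horizon and the d.o.c. are `T`-invariant and disjoint).
* `exists_bound_timeDrift_on_stationaryOrbit` — for an equivariant Killing time `t_f`
  (`t_f(φₛ p) = t_f(p) + s`, Chruściel–Costa 2008, Thm. 4.5) and a vector field `Z`, smooth on an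
  open `T`-invariant `W ⊆ ⟨⟨M_ext⟩⟩` with `[T, Z] = 0` there, the drift `dt_f(Z)` is `T`-invariant
  (`dφₜ Z = Z ∘ φₜ`, `t_f ∘ φₜ = t_f + t`) and continuous, hence bounded on `⋃ₜ θₜ(S)` for compact
  `S ⊆ W`.

Everything here is proved; no definitions, no named facts.  Used by the crux
`NonTrappingHawkingRigidity` (stub `stub_farAxialSeed`): the orbits of the continued axial field stay
in slabs of the radial function and their Killing time grows at bounded rate.

## References
* P. T. Chruściel, J. L. Costa, Astérisque 321 (2008), arXiv:0806.0016, §2.2, §4.2, Thm. 4.5. [ChruscielCosta2008]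
-/

noncomputable section

open Set Filter Function Bundle TopologicalSpace VectorField Literature.Geometry.Manifold
open scoped Manifold ContDiff Topology

namespace Literature.Geometry.Lorentzian

namespace StationaryAFBlackHole

variable (𝓑 : StationaryAFBlackHole.{0}) [𝓑.metric.HasLeviCivita]

/-- **A `T`-invariant radial function is bounded on the orbit of a compact set.** Let `ρ` be smooth on
the d.o.c. of `𝓑` with `dρ(T) = 0` there, and `ρ < c` on `U₁ ∩ ⟨⟨M_ext⟩⟩` for an open `U₁ ⊇ 𝓔⁺`.
Then for every compact `S ⊆ ⟨⟨M_ext⟩⟩ ∪ 𝓔⁺` there is `C` with `ρ y ≤ C` for all `y ∈ ⟨⟨M_ext⟩⟩` in the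
stationary orbit of `S`. Chruściel–Costa 2008, §4.2 (functions on the orbit space). [cite: ChruscielCosta2008, §4.2] -/
theorem exists_bound_radial_on_stationaryOrbit {ρ : 𝓑.carrier → ℝ}
    (hρs : ContMDiffOn (𝓡 4) 𝓘(ℝ, ℝ) ((⊤ : ℕ∞) : ℕ∞ω) ρ 𝓑.doc)
    (hρT : ∀ x ∈ 𝓑.doc, mfderiv (𝓡 4) 𝓘(ℝ, ℝ) ρ x (𝓑.killing x) = 0) {U₁ : Set 𝓑.carrier}
    {c : ℝ} (hU₁o : IsOpen U₁) (hHU₁ : 𝓑.horizon ⊆ U₁) (hU₁ρ : ∀ y ∈ U₁ ∩ 𝓑.doc, ρ y < c)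
    {S : Set 𝓑.carrier} (hS : IsCompact S) (hSsub : S ⊆ 𝓑.doc ∪ 𝓑.horizon) :
    ∃ C : ℝ, ∀ y ∈ 𝓑.doc, y ∈ stationaryOrbit 𝓑.killing S → ρ y ≤ C := by
  have hT : 𝓑.metric.toPseudoRiemannianMetric.IsKillingField 𝓑.killing :=
    𝓑.isStationaryKilling.isKillingField
  obtain ⟨θ, hθs, hθ0, hθadd, hθX, _⟩ := 𝓑.exists_stationary_flow
  have hT1 : ContMDiff (𝓡 4) (𝓡 4).tangent 1
      (fun y ↦ (⟨y, 𝓑.killing y⟩ : TangentBundle (𝓡 4) 𝓑.carrier)) :=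
    hT.contMDiff.of_le (WithTop.coe_le_coe.mpr le_top)
  have hdoc : IsOpen 𝓑.doc :=
    𝓑.isOpen_doc
      (LorentzianMetric.isOpen_chronologicalFuture_holds_of_boundaryless (g := 𝓑.metric)
        (τ := 𝓑.timeOrientation))
      (LorentzianMetric.isOpen_chronologicalPast_holds_of_boundaryless (g := 𝓑.metric)
        (τ := 𝓑.timeOrientation))
  have hθdoc : ∀ (t : ℝ) (a : 𝓑.carrier), a ∈ 𝓑.doc → θ (t, a) ∈ 𝓑.doc := fun t a ha ↦
    mem_doc_of_isMIntegralCurve (hθX a) (by simpa [hθ0] using ha) t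
  have hρinv : ∀ (t : ℝ) (a : 𝓑.carrier), a ∈ 𝓑.doc → ρ (θ (t, a)) = ρ a := by
    intro t a ha
    have h := PseudoRiemannianMetric.apply_eq_apply_of_isMIntegralCurveOn_of_mvfderiv_eq_zero
      (I := 𝓡 4) (O := 𝓑.doc) (Y := 𝓑.killing) (f := ρ)
      (fun y hy ↦ (hρs.contMDiffAt (hdoc.mem_nhds hy)).mdifferentiableAt (by simp))
      (fun y hy ↦ hρT y hy) isOpen_univ ordConnected_univ ((hθX a).isMIntegralCurveOn univ)
      (fun s _ ↦ hθdoc s a ha) (mem_univ t) (mem_univ 0)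
    simpa [hθ0] using h
  have hK₁c : IsCompact (S \ U₁) := hS.diff hU₁o
  have hK₁doc : S \ U₁ ⊆ 𝓑.doc := fun a ha ↦
    (hSsub ha.1).resolve_right fun hh ↦ ha.2 (hHU₁ hh)
  obtain ⟨C, hC⟩ := exists_bound_of_invariant_on_stationaryOrbit hT1 hθX hθ0 hK₁c
    (hρs.continuousOn.mono hK₁doc) (fun t a ha ↦ hρinv t a (hK₁doc ha))
  refine ⟨max C c, fun y hy hyS ↦ ?_⟩
  rw [stationaryOrbit_eq_iUnion_image_flow hT1 hθX hθ0] at hyS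
  obtain ⟨t, a, ha, rfl⟩ := by simpa only [mem_iUnion, mem_image] using hyS
  by_cases haU : a ∈ U₁
  · rcases hSsub ha with had | hah
    · rw [hρinv t a had]
      exact le_trans (hU₁ρ a ⟨haU, had⟩).le (le_max_right _ _)
    · exact absurd hy (Set.disjoint_left.1
        (𝓑.disjoint_horizon_doc
          (LorentzianMetric.isOpen_chronologicalPast_holds_of_boundaryless (g := 𝓑.metric)
            (τ := 𝓑.timeOrientation)))
        (mem_horizon_of_isMIntegralCurve (hθX a) (by simpa [hθ0] using hah) t))
  · have h := hC (θ (t, a)) ⟨fun s ↦ θ (s, a), hθX a, by simpa [hθ0] using (⟨ha, haU⟩ : a ∈ S \ U₁),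
      t, rfl⟩
    exact le_trans (le_trans (le_abs_self _) h) (le_max_left _ _)

/-- **The Killing-time drift of a `T`-commuting field is bounded on the orbit of a compact set.** Let
`W ⊆ ⟨⟨M_ext⟩⟩` be open and invariant under the stationary flow, `Z` a vector field smooth on `W` with
`[T, Z] = 0` on `W`, `T ≠ 0` on the d.o.c., and `t_f` smooth on the d.o.c. with
`t_f(γ s) = t_f(γ 0) + s` along the integral curves of `T` starting in the d.o.c.  Then for every
compact `S ⊆ W` there is `C` with `|dt_f(Z)(y)| ≤ C` for all `y` in the stationary orbit of `S`
(`dt_f(Z)(y)` as Mathlib's `mvfderiv`, definitionally `mfderiv (𝓡 4) 𝓘(ℝ, ℝ) t_f y (Z y)`):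
the drift `y ↦ dt_f(Z y)` is invariant under the flow (`dφₜ(Z y) = Z(φₜ y)` by commutation,
`t_f ∘ φₜ = t_f + t` near `y`) and continuous on `S`. Chruściel–Costa 2008, Thm. 4.5 (the flow is a
translation along the `ℝ` factor). [cite: ChruscielCosta2008, Thm. 4.5] -/
theorem exists_bound_timeDrift_on_stationaryOrbit {W : Set 𝓑.carrier} (hWo : IsOpen W)
    (hWdoc : W ⊆ 𝓑.doc)
    (hWT : ∀ γ : ℝ → 𝓑.carrier, IsMIntegralCurve γ 𝓑.killing → γ 0 ∈ W → ∀ t, γ t ∈ W)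
    {Z : Π x : 𝓑.carrier, TangentSpace (𝓡 4) x}
    (hZs : ContMDiffOn (𝓡 4) ((𝓡 4).prod 𝓘(ℝ, E4)) ((⊤ : ℕ∞) : ℕ∞ω)
      (fun x ↦ (TotalSpace.mk' E4 x (Z x) : TangentBundle (𝓡 4) 𝓑.carrier)) W)
    (hTZ : ∀ x ∈ W, mlieBracket (𝓡 4) 𝓑.killing Z x = 0) (hT0 : ∀ x ∈ 𝓑.doc, 𝓑.killing x ≠ 0)
    {tf : 𝓑.carrier → ℝ} (htfs : ContMDiffOn (𝓡 4) 𝓘(ℝ, ℝ) ((⊤ : ℕ∞) : ℕ∞ω) tf 𝓑.doc)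
    (htfeq : ∀ γ : ℝ → 𝓑.carrier, IsMIntegralCurve γ 𝓑.killing → γ 0 ∈ 𝓑.doc →
      ∀ s, tf (γ s) = tf (γ 0) + s)
    {S : Set 𝓑.carrier} (hS : IsCompact S) (hSW : S ⊆ W) :
    ∃ C : ℝ, ∀ y ∈ stationaryOrbit 𝓑.killing S, |mvfderiv (𝓡 4) tf y (Z y)| ≤ C := by
  have hT : 𝓑.metric.toPseudoRiemannianMetric.IsKillingField 𝓑.killing :=
    𝓑.isStationaryKilling.isKillingField
  obtain ⟨θ, hθs, hθ0, hθadd, hθX, _⟩ := 𝓑.exists_stationary_flow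
  have hθ2 : ContMDiff (𝓘(ℝ, ℝ).prod (𝓡 4)) (𝓡 4) 2 θ := hθs.of_le (WithTop.coe_le_coe.mpr le_top)
  have hT1 : ContMDiff (𝓡 4) (𝓡 4).tangent 1
      (fun y ↦ (⟨y, 𝓑.killing y⟩ : TangentBundle (𝓡 4) 𝓑.carrier)) :=
    hT.contMDiff.of_le (WithTop.coe_le_coe.mpr le_top)
  have hdoc : IsOpen 𝓑.doc :=
    𝓑.isOpen_doc
      (LorentzianMetric.isOpen_chronologicalFuture_holds_of_boundaryless (g := 𝓑.metric)
        (τ := 𝓑.timeOrientation))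
      (LorentzianMetric.isOpen_chronologicalPast_holds_of_boundaryless (g := 𝓑.metric)
        (τ := 𝓑.timeOrientation))
  have hθdoc : ∀ (t : ℝ) (a : 𝓑.carrier), a ∈ 𝓑.doc → θ (t, a) ∈ 𝓑.doc := fun t a ha ↦
    mem_doc_of_isMIntegralCurve (hθX a) (by simpa [hθ0] using ha) t
  have hθW : ∀ (t : ℝ) (a : 𝓑.carrier), a ∈ W → θ (t, a) ∈ W := fun t a ha ↦
    hWT (fun s ↦ θ (s, a)) (hθX a) (by simpa [hθ0] using ha) t
  have htfeq' : ∀ (t : ℝ) (a : 𝓑.carrier), a ∈ 𝓑.doc → tf (θ (t, a)) = tf a + t := by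
    intro t a ha
    have h := htfeq (fun s ↦ θ (s, a)) (hθX a) (by simpa [hθ0] using ha) t
    simpa [hθ0] using h
  have hdtf : ∀ q ∈ 𝓑.doc, MDifferentiableAt (𝓡 4) 𝓘(ℝ, ℝ) tf q := fun q hq ↦
    (htfs.contMDiffAt (hdoc.mem_nhds hq)).mdifferentiableAt (by simp)
  set F : 𝓑.carrier → ℝ := fun y ↦ mvfderiv (𝓡 4) tf y (Z y) with hF
  have hFcont : ContinuousOn F S := by
    intro a ha
    have had : a ∈ 𝓑.doc := hWdoc (hSW ha)
    have h1 : ContMDiffAt (𝓡 4) 𝓘(ℝ, ℝ) 2 tf a :=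
      (htfs.contMDiffAt (hdoc.mem_nhds had)).of_le (WithTop.coe_le_coe.mpr le_top)
    have h2 : ContMDiffAt (𝓡 4) (𝓡 4).tangent 1
        (fun y ↦ (⟨y, Z y⟩ : TangentBundle (𝓡 4) 𝓑.carrier)) a :=
      (hZs.contMDiffAt (hWo.mem_nhds (hSW ha))).of_le (WithTop.coe_le_coe.mpr le_top)
    exact (contMDiffAt_mvfderiv_apply h1 h2).continuousAt.continuousWithinAt
  have hFinv : ∀ (t : ℝ), ∀ a ∈ S, F (θ (t, a)) = F a := by
    intro t a ha
    have haW : a ∈ W := hSW ha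
    have had : a ∈ 𝓑.doc := hWdoc haW
    have hZθ : mfderiv (𝓡 4) (𝓡 4) (fun q ↦ θ (t, q)) a (Z a) = Z (θ (t, a)) :=
      mfderiv_flow_apply_eq_of_forall_uIcc_mem hT.contMDiff hWo
        (fun y hy ↦ hZs.contMDiffAt (hWo.mem_nhds hy)) hTZ hθ2 hθX hθ0 hθadd (hT0 a had)
        (fun s _ ↦ hθW s a haW)
    have hev : (tf ∘ fun q ↦ θ (t, q)) =ᶠ[𝓝 a] fun q ↦ tf q + t := by
      filter_upwards [hdoc.mem_nhds had] with q hq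
      exact htfeq' t q hq
    have hdθ : MDifferentiableAt (𝓡 4) (𝓡 4) (fun q ↦ θ (t, q)) a :=
      PseudoRiemannianMetric.mdifferentiableAt_flow hθ2 t a
    -- the two expressions of the derivative of `tf ∘ θₜ` at `a`
    have hc1 : HasMFDerivAt (𝓡 4) 𝓘(ℝ, ℝ) (tf ∘ fun q ↦ θ (t, q)) a
        ((mfderiv (𝓡 4) 𝓘(ℝ, ℝ) tf (θ (t, a))).comp
          (mfderiv (𝓡 4) (𝓡 4) (fun q ↦ θ (t, q)) a)) :=
      (hdtf _ (hθdoc t a had)).hasMFDerivAt.comp a hdθ.hasMFDerivAt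
    have hc2 : HasMFDerivAt (𝓡 4) 𝓘(ℝ, ℝ) (tf ∘ fun q ↦ θ (t, q)) a
        ((show TangentSpace (𝓡 4) a →L[ℝ] ℝ from mfderiv (𝓡 4) 𝓘(ℝ, ℝ) tf a) +
          (0 : TangentSpace (𝓡 4) a →L[ℝ] ℝ)) :=
      ((hdtf a had).hasMFDerivAt.add
        (hasMFDerivAt_const (I := 𝓡 4) (I' := 𝓘(ℝ, ℝ)) t a)).congr_of_eventuallyEq hev
    have h12 := congrArg (fun L : TangentSpace (𝓡 4) a →L[ℝ] ℝ ↦ L (Z a))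
      (hc1.mfderiv.symm.trans hc2.mfderiv)
    have h3 : (mfderiv (𝓡 4) 𝓘(ℝ, ℝ) tf (θ (t, a)) : TangentSpace (𝓡 4) (θ (t, a)) →L[ℝ] ℝ)
        (Z (θ (t, a))) =
        (mfderiv (𝓡 4) 𝓘(ℝ, ℝ) tf (θ (t, a)) : TangentSpace (𝓡 4) (θ (t, a)) →L[ℝ] ℝ)
          (mfderiv (𝓡 4) (𝓡 4) (fun q ↦ θ (t, q)) a (Z a)) :=
      congrArg (mfderiv (𝓡 4) 𝓘(ℝ, ℝ) tf (θ (t, a))) hZθ.symm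
    show (mfderiv (𝓡 4) 𝓘(ℝ, ℝ) tf (θ (t, a)) : TangentSpace (𝓡 4) (θ (t, a)) →L[ℝ] ℝ)
        (Z (θ (t, a))) = (mfderiv (𝓡 4) 𝓘(ℝ, ℝ) tf a : TangentSpace (𝓡 4) a →L[ℝ] ℝ) (Z a)
    rw [h3]
    have h12' : (show ℝ from (mfderiv (𝓡 4) 𝓘(ℝ, ℝ) tf (θ (t, a)))
          (mfderiv (𝓡 4) (𝓡 4) (fun q ↦ θ (t, q)) a (Z a))) =
        (show ℝ from (mfderiv (𝓡 4) 𝓘(ℝ, ℝ) tf a) (Z a)) + (0 : ℝ) := h12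
    rw [add_zero] at h12'
    exact h12'
  obtain ⟨C, hC⟩ := exists_bound_of_invariant_on_stationaryOrbit hT1 hθX hθ0 hS hFcont hFinv
  exact ⟨C, hC⟩

end StationaryAFBlackHole

end Literature.Geometry.Lorentzian

end
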